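import Literature.NumberTheory.EllipticCurves.IwasawaTwistModP
import HarnessLib

/-!
# A homothety is central in the image of the twisted action on `𝒯_J`

Glue for the `μ`-transfer core of BSD crux 19276 (HOME/koly/MU-TRANSFER-PROOF.md (F8): Sah's
lemma "with a non-trivial central homothety"): if `z ∈ Γ_K` acts on `M` by a scalar `a`, then on
`𝒯_J = M ⊗ 𝔽_p[T]/T^J (χ_κ)` it acts by `a·(1+S)^{κ(z)}`, which commutes with every
`ρ(σ) ⊗ (1+S)^{κ(σ)}` (`twistModPRepresentation_mul_comm_of_smul`); hence `z` is central modulo the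
kernel `N` of the action on `𝒯_J` (`mk_mem_center_quotient_ker_of_smul`) — the hypothesis `hzc` of
`galoisCohomology.exists_mem_apply_ne_zero_of_isOpen`.
-/

noncomputable section

open Field

universe u

namespace Literature.NumberTheory.EllipticCurves.ZpExtension

open Literature.NumberTheory.GaloisRepresentations

variable {K : Type u} [Field K] {p : ℕ} [Fact p.Prime] (κ : ZpExtension K p)
  {M : Type u} [AddCommGroup M] [TopologicalSpace M] [DiscreteTopology M]
  (ρ : DiscreteGaloisModule K M) (hM : ∀ x : M, p • x = 0) (J : ℕ)

omit [TopologicalSpace M] [DiscreteTopology M] in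
/-- A homothety `m ↦ a·m`, pushed to `M^J` coordinatewise, is the scalar `a`.
[cite: Washington1997, §13.1–§13.2] -/
theorem compLeft_eq_smul_one_of_smul (f : M →ₗ[ℤ] M) {a : ℤ} (hf : ∀ m : M, f m = a • m) :
    f.compLeft (Fin J) = a • (1 : Module.End ℤ (Fin J → M)) :=
  LinearMap.ext fun x => funext fun i => by
    rw [LinearMap.smul_apply, Module.End.one_apply, Pi.smul_apply, ← hf]; rfl

/-- **A homothety commutes with the whole twisted action**: if `ρ(z) = a` is a scalar on `M`, then
`𝒯_J(z) 𝒯_J(σ) = 𝒯_J(σ) 𝒯_J(z)` for every `σ ∈ Γ_K` (`a(1+S)^{κ(z)}` is central in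
`End(M) ⊗ 𝔽_p[T]/T^J`). [cite: Washington1997, §13.1–§13.2] -/
theorem twistModPRepresentation_mul_comm_of_smul {z : absoluteGaloisGroup K} {a : ℤ}
    (hz : ∀ m : M, ρ z m = a • m) (σ : absoluteGaloisGroup K) :
    κ.twistModPRepresentation ρ hM J z * κ.twistModPRepresentation ρ hM J σ =
      κ.twistModPRepresentation ρ hM J σ * κ.twistModPRepresentation ρ hM J z := by
  have hZ : κ.twistModPRepresentation ρ hM J z = a • unipotentPow M J (κ.twistExponent J z) := by
    change unipotentPow M J (κ.twistExponent J z) * (ρ z).compLeft (Fin J) = _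
    rw [compLeft_eq_smul_one_of_smul J (ρ z) hz, mul_smul_comm, mul_one]
  have hσ : κ.twistModPRepresentation ρ hM J σ =
      unipotentPow M J (κ.twistExponent J σ) * (ρ σ).compLeft (Fin J) := rfl
  rw [hZ, hσ, smul_mul_assoc, mul_smul_comm]
  congr 1
  rw [mul_assoc, ← unipotentPow_mul_compLeft, ← mul_assoc, ← mul_assoc, ← unipotentPow_add,
    ← unipotentPow_add, add_comm]

/-- **`z` is central modulo the kernel of the action on `𝒯_J`** when `ρ(z)` is a scalar: the
hypothesis `hzc` of Sah's lemma (`galoisCohomology.exists_mem_apply_ne_zero_of_isOpen`) for the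
subgroup `N = ker(Γ_K → Aut 𝒯_J)`. [cite: Washington1997, §13.1–§13.2] [cite: Sah1968, Prop. 2.7 (b)] -/
theorem mk_mem_center_quotient_ker_of_smul {z : absoluteGaloisGroup K} {a : ℤ}
    (hz : ∀ m : M, ρ z m = a • m) :
    (z : absoluteGaloisGroup K ⧸ (κ.twistModPRepresentation ρ hM J).ker) ∈
      Subgroup.center (absoluteGaloisGroup K ⧸ (κ.twistModPRepresentation ρ hM J).ker) := by
  rw [Subgroup.mem_center_iff]
  intro g
  induction g using QuotientGroup.induction_on with
  | H σ =>
    rw [← QuotientGroup.mk_mul, ← QuotientGroup.mk_mul, QuotientGroup.eq, MonoidHom.mem_ker,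
      map_mul, show κ.twistModPRepresentation ρ hM J (z * σ) =
        κ.twistModPRepresentation ρ hM J (σ * z) by
          rw [map_mul, map_mul, twistModPRepresentation_mul_comm_of_smul κ ρ hM J hz σ],
      ← map_mul, inv_mul_cancel, map_one]

/-- **The kernel of the action on `𝒯_J` is open** when `M` is finite (finite intersection of the
open stabilisers of the discrete module `𝒯_J`): the subgroup `N = Gal(K̄/L₀)`, `L₀ = K(𝒯_J)`, of
(F8). [cite: Washington1997, §13.1–§13.2] -/
theorem isOpen_ker_twistModPRepresentation [Finite M] :
    IsOpen ((κ.twistModPRepresentation ρ hM J).ker : Set (absoluteGaloisGroup K)) := by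
  have h : ((κ.twistModPRepresentation ρ hM J).ker : Set (absoluteGaloisGroup K)) =
      ⋂ x : Fin J → M, {σ : absoluteGaloisGroup K | κ.twistModP ρ hM J σ x = x} := by
    ext σ
    simp only [SetLike.mem_coe, MonoidHom.mem_ker, Set.mem_iInter, Set.mem_setOf_eq]
    constructor
    · intro hσ x
      change κ.twistModPRepresentation ρ hM J σ x = x
      rw [hσ, Module.End.one_apply]
    · intro hσ
      exact LinearMap.ext fun x => hσ x
  rw [h]
  exact isOpen_iInter_of_finite fun x => (κ.twistModP ρ hM J).isOpen_setOf_apply_eq x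

/-- The kernel of the action acts trivially on `𝒯_J` (in the `TopRep` spelling of the cocycle
lemmas, hypothesis `hS` of `LevelE.valueSubgroup_eq_top`). [cite: Washington1997, §13.1–§13.2] -/
theorem toTopRep_ρ_apply_eq_self_of_mem_ker {τ : absoluteGaloisGroup K}
    (hτ : τ ∈ (κ.twistModPRepresentation ρ hM J).ker) (x : (κ.twistModP ρ hM J).toTopRep) :
    (κ.twistModP ρ hM J).toTopRep.ρ τ x = x := by
  change κ.twistModPRepresentation ρ hM J τ x = x
  rw [MonoidHom.mem_ker.mp hτ, Module.End.one_apply]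

end Literature.NumberTheory.EllipticCurves.ZpExtension

end
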